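import Literature.Computability.Cryptography.LWENoiseWidth
import HarnessLib

/-!
# BLPRS 2013, p. 13 / Lemma 2.15 for a finite-precision machine: a RATIONAL grid of noise raisings one of which almost hits the target rate

Topic `Computability/Cryptography` (LWE), grouping namespace `BLPRS2013`. In the chain Thm. 4.1 → Cor. 3.2 →
Lemma 2.15 (`BLPRSRateGuess.lean`, `BLPRSSection4Assembly.lean`) the row of guess `w` raises the noise by `τ_w`, and
the analysis needs, for every binary secret `z` (input rate `ρ = ρ₀(z̄)`, `‖z‖² = h ≤ B²`), SOME guess whose final
rate `a = √(ρ² + r²(h + B²) + τ_w²)` makes the oracle's advantage large — exactly `α` in the paper. A coin-driven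
machine samples the continuous part of a switched sample as `κ·g`, `g ← 𝒩(0,½)`, `κ = q'σ/√π`, `σ² = (rB)² + τ²`
(`LWERoundingApprox.lean`), with a RATIONAL multiplier; hitting `α` exactly would need the digits of `π`. Instead the
guesses index a grid of multipliers `κ₀ + i/D` (`κ₀ = q'rB/√π`, rational by the choice of `r`): this file defines the
corresponding raisings and proves that one of them lands within `2√π/(Dq')` BELOW `α`, whence the discretised
Gaussians are `8√π/(Dq'α)`-close (Regev's Claim 2.2, `LWE.tvDist_discretizedGaussian_le`) — the tolerance that
`BLPRSSection4Assembly.four_theta_le_adv_of_tvDist_le` converts into the hypothesis of `advantage_rateGuess_hybridH₀'`.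
Everything PROVED; one definition with body (`gridTau`); no named fact.

* `gridTau q' κ₀ D G i = √(π((κ₀ + i/D)² - κ₀²))/q'`, `gridTau_sq`, **`multiplier_gridTau`**
  (`q'²((rB)² + τᵢ²)/π = (κ₀ + i/D)²`: the machine's multiplier is `κ₀ + i/D` EXACTLY);
* **`exists_gridTau_close`** — if `ρ² + r²(h + B²) ≤ α²` (the noise budget) and `G ≥ q'αD/√π + 1`, some `i < G` has
  final rate `a ≤ α` with `α - a ≤ 2√π/(Dq')`;
* **`exists_gridTau_tvDist_le`** — hence, if moreover `4√π/(Dq') ≤ α`, `Δ(Ψ̄_{q'}(a), Ψ̄_{q'}(α)) ≤ 8√π/(Dq'α)`.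

## References

* Z. Brakerski, A. Langlois, C. Peikert, O. Regev, D. Stehlé, *Classical hardness of learning with errors*, STOC 2013;
  arXiv:1306.0281, p. 13 ("combining Theorem 4.1 and Corollary 3.2 … Lemma 2.15"), Lemma 2.15 (unknown noise rate),
  §5 (finite precision). [BrakerskiEtAl2013]
* O. Regev, *On lattices, learning with errors …*, J. ACM 56 (2009), Claim 2.2 and Lemma 3.7 (proof: a grid of
  noise amounts). [RegevLWE2009]
-/

noncomputable section

open scoped Real

namespace Literature.Computability.Cryptography

namespace BLPRS2013

/-! ### The grid of raisings -/

/-- **The noise raising of guess `i`**: `τᵢ = √(π((κ₀ + i/D)² - κ₀²))/q'`, so that the multiplier of the machine's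
Gaussian is `κ₀ + i/D`. [cite: BrakerskiEtAl2013, p. 13 with §5; RegevLWE2009, Lemma 3.7 (proof)] -/
def gridTau (q' : ℕ) (κ₀ : ℝ) (D G : ℕ) (i : Fin G) : ℝ :=
  Real.sqrt (π * ((κ₀ + (i : ℝ) / D) ^ 2 - κ₀ ^ 2)) / q'

/-- `τᵢ² = π((κ₀ + i/D)² - κ₀²)/q'²` (`κ₀ ≥ 0`). [folklore] -/
theorem gridTau_sq {q' : ℕ} {κ₀ : ℝ} (hκ₀ : 0 ≤ κ₀) (D G : ℕ) (i : Fin G) :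
    gridTau q' κ₀ D G i ^ 2 = π * ((κ₀ + (i : ℝ) / D) ^ 2 - κ₀ ^ 2) / (q' : ℝ) ^ 2 := by
  have hi : κ₀ ≤ κ₀ + (i : ℝ) / D := le_add_of_nonneg_right (by positivity)
  have hsq : κ₀ ^ 2 ≤ (κ₀ + (i : ℝ) / D) ^ 2 := pow_le_pow_left₀ hκ₀ hi 2
  rw [gridTau, div_pow, Real.sq_sqrt (mul_nonneg Real.pi_pos.le (sub_nonneg.2 hsq))]

/-- **The machine's multiplier is `κ₀ + i/D` exactly**: with `κ₀ = q'rB/√π`,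
`q'²((rB)² + τᵢ²)/π = (κ₀ + i/D)²`. [cite: BrakerskiEtAl2013, §5] -/
theorem multiplier_gridTau {q' : ℕ} (hq : 0 < q') {r B : ℝ} (hrB : 0 ≤ r * B) (D G : ℕ) (i : Fin G) :
    (q' : ℝ) ^ 2 * ((r * B) ^ 2 + gridTau q' ((q' : ℝ) * r * B / √π) D G i ^ 2) / π =
      ((q' : ℝ) * r * B / √π + (i : ℝ) / D) ^ 2 := by
  have hq' : (0 : ℝ) < q' := by exact_mod_cast hq
  have hπ := Real.pi_pos
  have hsπ : (0 : ℝ) < √π := Real.sqrt_pos.2 hπ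
  have hκ₀ : 0 ≤ (q' : ℝ) * r * B / √π := by rw [mul_assoc]; positivity
  rw [gridTau_sq hκ₀]
  have hκ₀sq : ((q' : ℝ) * r * B / √π) ^ 2 = (q' : ℝ) ^ 2 * (r * B) ^ 2 / π := by
    rw [div_pow, Real.sq_sqrt hπ.le]; ring
  rw [hκ₀sq]
  field_simp
  ring

/-- The final rate of guess `i` in closed form: `ρ² + r²(h + B²) + τᵢ² = ρ² + r²h + π(κ₀ + i/D)²/q'²`, `κ₀ = q'rB/√π`.
[folklore] -/
theorem rate_sq_gridTau {q' : ℕ} (hq : 0 < q') {r B : ℝ} (hrB : 0 ≤ r * B) (ρ h : ℝ) (D G : ℕ) (i : Fin G) :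
    ρ ^ 2 + r ^ 2 * (h + B ^ 2) + gridTau q' ((q' : ℝ) * r * B / √π) D G i ^ 2 =
      ρ ^ 2 + r ^ 2 * h + π * ((q' : ℝ) * r * B / √π + (i : ℝ) / D) ^ 2 / (q' : ℝ) ^ 2 := by
  have hq' : (0 : ℝ) < q' := by exact_mod_cast hq
  rw [← multiplier_gridTau hq hrB D G i]
  field_simp
  ring

/-! ### One guess almost hits the target rate -/

/-- **Some raising lands just below the target**: under the noise budget `ρ² + r²(h + B²) ≤ α²` and with
`G ≥ q'αD/√π + 1` guesses, some `i` has final rate `a = √(√(ρ² + r²(h+B²))² + τᵢ²) ≤ α` with `α - a ≤ 2√π/(Dq')`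
(take `i = ⌊(κ⋆ - κ₀)D⌋`, `κ⋆ = q'√(α² - ρ² - r²h)/√π` the exact multiplier).
[cite: BrakerskiEtAl2013, p. 13 with §5; RegevLWE2009, Lemma 3.7 (proof)] -/
theorem exists_gridTau_close {q' : ℕ} (hq : 0 < q') {r B ρ h α : ℝ} (hr : 0 ≤ r) (hB : 0 ≤ B) (hh : 0 ≤ h)
    (hα : 0 < α) (hbudget : ρ ^ 2 + r ^ 2 * (h + B ^ 2) ≤ α ^ 2) {D G : ℕ} (hD : 0 < D)
    (hG : (q' : ℝ) * α * D / √π + 1 ≤ G) :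
    ∃ i : Fin G,
      Real.sqrt (Real.sqrt (ρ ^ 2 + r ^ 2 * (h + B ^ 2)) ^ 2 + gridTau q' ((q' : ℝ) * r * B / √π) D G i ^ 2) ≤ α ∧
      α - Real.sqrt (Real.sqrt (ρ ^ 2 + r ^ 2 * (h + B ^ 2)) ^ 2 + gridTau q' ((q' : ℝ) * r * B / √π) D G i ^ 2) ≤
        2 * √π / (D * q') := by
  have hq' : (0 : ℝ) < q' := by exact_mod_cast hq
  have hD' : (0 : ℝ) < D := by exact_mod_cast hD
  have hπ := Real.pi_pos
  have hsπ : (0 : ℝ) < √π := Real.sqrt_pos.2 hπ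
  have hrB : 0 ≤ r * B := mul_nonneg hr hB
  -- the least multiplier `κ₀` and the exact one `K`
  obtain ⟨κ₀, hκ₀def⟩ : ∃ κ₀ : ℝ, κ₀ = (q' : ℝ) * r * B / √π := ⟨_, rfl⟩
  have hκ₀ : 0 ≤ κ₀ := by rw [hκ₀def, mul_assoc]; positivity
  have hE0 : 0 ≤ α ^ 2 - ρ ^ 2 - r ^ 2 * h := by nlinarith [sq_nonneg (r * B)]
  obtain ⟨K, hKdef⟩ : ∃ K : ℝ, K = (q' : ℝ) * Real.sqrt (α ^ 2 - ρ ^ 2 - r ^ 2 * h) / √π := ⟨_, rfl⟩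
  have hK0 : 0 ≤ K := by rw [hKdef]; positivity
  have hrootB : r * B ≤ Real.sqrt (α ^ 2 - ρ ^ 2 - r ^ 2 * h) := by
    rw [← Real.sqrt_sq hrB]
    exact Real.sqrt_le_sqrt (by nlinarith)
  have hrootα : Real.sqrt (α ^ 2 - ρ ^ 2 - r ^ 2 * h) ≤ α := by
    rw [Real.sqrt_le_left hα.le]
    nlinarith [sq_nonneg ρ]
  have hκ₀K : κ₀ ≤ K := by
    rw [hκ₀def, hKdef, mul_assoc]
    exact div_le_div_of_nonneg_right (mul_le_mul_of_nonneg_left hrootB hq'.le) hsπ.le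
  have hKα : K ≤ (q' : ℝ) * α / √π := by
    rw [hKdef]
    exact div_le_div_of_nonneg_right (mul_le_mul_of_nonneg_left hrootα hq'.le) hsπ.le
  have hKsq : π * K ^ 2 / (q' : ℝ) ^ 2 = α ^ 2 - ρ ^ 2 - r ^ 2 * h := by
    rw [hKdef, div_pow, mul_pow, Real.sq_sqrt hE0, Real.sq_sqrt hπ.le]
    field_simp
  -- the guess `i₀ = ⌊(K - κ₀)D⌋`
  obtain ⟨i₀, hi₀def⟩ : ∃ i₀ : ℕ, i₀ = ⌊(K - κ₀) * D⌋₊ := ⟨_, rfl⟩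
  have hx0 : 0 ≤ (K - κ₀) * D := mul_nonneg (sub_nonneg.2 hκ₀K) hD'.le
  have hfl : (i₀ : ℝ) ≤ (K - κ₀) * D := by rw [hi₀def]; exact Nat.floor_le hx0
  have hlt : (K - κ₀) * D < (i₀ : ℝ) + 1 := by rw [hi₀def]; exact Nat.lt_floor_add_one _
  have hi₀G : i₀ < G := by
    have h1 : (i₀ : ℝ) ≤ (q' : ℝ) * α * D / √π := by
      have h2 : (K - κ₀) * D ≤ K * D := mul_le_mul_of_nonneg_right (by linarith) hD'.le
      have h3 : K * D ≤ (q' : ℝ) * α / √π * D := mul_le_mul_of_nonneg_right hKα hD'.le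
      have h4 : (q' : ℝ) * α / √π * D = (q' : ℝ) * α * D / √π := by ring
      linarith
    have h2 : (i₀ : ℝ) < G := by linarith
    exact_mod_cast h2
  refine ⟨⟨i₀, hi₀G⟩, ?_⟩
  rw [← hκ₀def]
  -- its multiplier `κi = κ₀ + i₀/D ∈ [K - 1/D, K]`
  obtain ⟨κi, hκidef⟩ : ∃ κi : ℝ, κi = κ₀ + (i₀ : ℝ) / D := ⟨_, rfl⟩
  have hκiK : κi ≤ K := by
    have : (i₀ : ℝ) / D ≤ K - κ₀ := by rw [div_le_iff₀ hD']; exact hfl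
    rw [hκidef]; linarith
  have hKκi : K ≤ κi + 1 / D := by
    have : K - κ₀ < ((i₀ : ℝ) + 1) / D := by rw [lt_div_iff₀ hD']; exact hlt
    rw [add_div] at this
    rw [hκidef]; linarith
  have hκi0 : 0 ≤ κi := by rw [hκidef]; positivity
  -- the final rate `a` of the guess: `a² = ρ² + r²h + πκi²/q'²`, `α² = ρ² + r²h + πK²/q'²`
  have hS0 : 0 ≤ ρ ^ 2 + r ^ 2 * (h + B ^ 2) := by positivity
  obtain ⟨a, hadef⟩ : ∃ a : ℝ, a = Real.sqrt (Real.sqrt (ρ ^ 2 + r ^ 2 * (h + B ^ 2)) ^ 2 + gridTau q' κ₀ D G ⟨i₀, hi₀G⟩ ^ 2) :=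
    ⟨_, rfl⟩
  rw [← hadef]
  have ha0 : 0 ≤ a := by rw [hadef]; exact Real.sqrt_nonneg _
  have hasq : a ^ 2 = ρ ^ 2 + r ^ 2 * h + π * κi ^ 2 / (q' : ℝ) ^ 2 := by
    rw [hadef, Real.sq_sqrt (by positivity), Real.sq_sqrt hS0, hκidef, hκ₀def]
    exact rate_sq_gridTau hq hrB ρ h D G ⟨i₀, hi₀G⟩
  have hαsq : α ^ 2 = ρ ^ 2 + r ^ 2 * h + π * K ^ 2 / (q' : ℝ) ^ 2 := by linarith [hKsq]
  have hdiff : α ^ 2 - a ^ 2 = π * (K ^ 2 - κi ^ 2) / (q' : ℝ) ^ 2 := by rw [hasq, hαsq]; ring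
  -- `a ≤ α`
  have hsq_le : a ^ 2 ≤ α ^ 2 := by
    have h1 : κi ^ 2 ≤ K ^ 2 := pow_le_pow_left₀ hκi0 hκiK 2
    have h2 : 0 ≤ π * (K ^ 2 - κi ^ 2) / (q' : ℝ) ^ 2 :=
      div_nonneg (mul_nonneg hπ.le (sub_nonneg.2 h1)) (by positivity)
    linarith
  have haα : a ≤ α := (pow_le_pow_iff_left₀ ha0 hα.le two_ne_zero).1 hsq_le
  refine ⟨haα, ?_⟩
  -- `α - a ≤ 2√π/(Dq')`: `α² - a² = π(K - κi)(K + κi)/q'² ≤ 2πK/(Dq'²) ≤ 2√πα/(Dq')`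
  have hgap : α ^ 2 - a ^ 2 ≤ 2 * √π * α / (D * q') := by
    rw [hdiff]
    have h1 : K ^ 2 - κi ^ 2 ≤ (1 / D) * (2 * K) := by
      have e : K ^ 2 - κi ^ 2 = (K - κi) * (K + κi) := by ring
      rw [e]
      have hA : K - κi ≤ 1 / D := by linarith
      have hB' : K + κi ≤ 2 * K := by linarith
      calc (K - κi) * (K + κi) ≤ (1 / D) * (K + κi) := mul_le_mul_of_nonneg_right hA (by linarith)
        _ ≤ (1 / D) * (2 * K) := mul_le_mul_of_nonneg_left hB' (by positivity)
    have hπK : π * K ≤ √π * ((q' : ℝ) * α) := by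
      have e : √π * ((q' : ℝ) * α / √π) = (q' : ℝ) * α := by field_simp
      calc π * K = √π * (√π * K) := by rw [← mul_assoc, Real.mul_self_sqrt hπ.le]
        _ ≤ √π * (√π * ((q' : ℝ) * α / √π)) :=
            mul_le_mul_of_nonneg_left (mul_le_mul_of_nonneg_left hKα hsπ.le) hsπ.le
        _ = √π * ((q' : ℝ) * α) := by rw [e]
    calc π * (K ^ 2 - κi ^ 2) / (q' : ℝ) ^ 2 ≤ π * ((1 / D) * (2 * K)) / (q' : ℝ) ^ 2 :=
          div_le_div_of_nonneg_right (mul_le_mul_of_nonneg_left h1 hπ.le) (by positivity)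
      _ = 2 * (π * K) / (D * (q' : ℝ) ^ 2) := by field_simp
      _ ≤ 2 * (√π * ((q' : ℝ) * α)) / (D * (q' : ℝ) ^ 2) :=
          div_le_div_of_nonneg_right (mul_le_mul_of_nonneg_left hπK (by norm_num)) (by positivity)
      _ = 2 * √π * α / (D * q') := by field_simp
  by_cases hle : α ≤ a
  · have : 0 ≤ 2 * √π / (D * q') := by positivity
    linarith
  · push Not at hle
    have key : (α - a) * α ≤ 2 * √π * α / (D * q') := by
      calc (α - a) * α ≤ (α - a) * (α + a) := mul_le_mul_of_nonneg_left (by linarith) (by linarith)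
        _ = α ^ 2 - a ^ 2 := by ring
        _ ≤ 2 * √π * α / (D * q') := hgap
    have h3 : α - a ≤ 2 * √π * α / (D * q') / α := by rw [le_div_iff₀ hα]; exact key
    refine h3.trans (le_of_eq ?_)
    field_simp

/-- **… so its discretised Gaussian is close to the target's**: if moreover `4√π/(Dq') ≤ α`, some `i < G` has
`a ≤ α` and `Δ(Ψ̄_{q'}(a), Ψ̄_{q'}(α)) ≤ 8√π/(Dq'α)` (Regev's Claim 2.2: `Δ ≤ 2(α/a - 1)` for `a ≤ α ≤ 2a`).
[cite: BrakerskiEtAl2013, p. 13 with §5; RegevLWE2009, Claim 2.2] -/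
theorem exists_gridTau_tvDist_le {q' : ℕ} [NeZero q'] {r B ρ h α : ℝ} (hr : 0 ≤ r) (hB : 0 ≤ B) (hh : 0 ≤ h)
    (hα : 0 < α) (hbudget : ρ ^ 2 + r ^ 2 * (h + B ^ 2) ≤ α ^ 2) {D G : ℕ} (hD : 0 < D)
    (hG : (q' : ℝ) * α * D / √π + 1 ≤ G) (hDα : 4 * √π / (D * q') ≤ α) :
    ∃ i : Fin G,
      Real.sqrt (Real.sqrt (ρ ^ 2 + r ^ 2 * (h + B ^ 2)) ^ 2 + gridTau q' ((q' : ℝ) * r * B / √π) D G i ^ 2) ≤ α ∧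
      (LWE.discretizedGaussian q'
          (Real.sqrt (Real.sqrt (ρ ^ 2 + r ^ 2 * (h + B ^ 2)) ^ 2 + gridTau q' ((q' : ℝ) * r * B / √π) D G i ^ 2))).tvDist
        (LWE.discretizedGaussian q' α) ≤ 8 * √π / (D * q' * α) := by
  have hq : 0 < q' := Nat.pos_of_ne_zero (NeZero.ne q')
  have hq' : (0 : ℝ) < q' := by exact_mod_cast hq
  have hD' : (0 : ℝ) < D := by exact_mod_cast hD
  obtain ⟨i, hle, hclose⟩ := exists_gridTau_close hq hr hB hh hα hbudget hD hG
  refine ⟨i, hle, ?_⟩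
  obtain ⟨a, ha⟩ : ∃ a : ℝ, a = Real.sqrt (Real.sqrt (ρ ^ 2 + r ^ 2 * (h + B ^ 2)) ^ 2 + gridTau q' ((q' : ℝ) * r * B / √π) D G i ^ 2) :=
    ⟨_, rfl⟩
  rw [← ha] at hle hclose ⊢
  have ha2 : α / 2 ≤ a := by
    have : 2 * √π / (D * q') ≤ α / 2 := by
      rw [show 4 * √π / (D * q') = 2 * (2 * √π / (D * q')) by ring] at hDα
      linarith
    linarith
  have hapos : 0 < a := by linarith
  have h2a : α ≤ 2 * a := by linarith
  refine (LWE.tvDist_discretizedGaussian_le q' hapos hle h2a).trans ?_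
  -- `2(α/a - 1) = 2(α - a)/a ≤ 2·(2√π/(Dq'))/(α/2)`
  rw [show α / a - 1 = (α - a) / a by field_simp]
  rw [mul_div_assoc']
  rw [div_le_iff₀ hapos]
  have hnum : 2 * (α - a) ≤ 4 * √π / (D * q') := by
    rw [show 4 * √π / (D * q') = 2 * (2 * √π / (D * q')) by ring]
    linarith
  calc 2 * (α - a) ≤ 4 * √π / (D * q') := hnum
    _ = 8 * √π / (D * q' * α) * (α / 2) := by field_simp; ring
    _ ≤ 8 * √π / (D * q' * α) * a := mul_le_mul_of_nonneg_left ha2 (by positivity)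

end BLPRS2013

end Literature.Computability.Cryptography

end
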